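import Literature.AlgebraicGeometry.Frobenioids.CircleOpensArcs
import HarnessLib

/-!
# Frobenioids II, Lemma 3.2: sub-arcs of an arc (`(A, B)`-subsets)

Mochizuki, *The geometry of Frobenioids II*, Kyushu J. Math. **62** (2008) 401–460, §3, Lemma 3.2
pp. 25–26 [cite: MochizukiFrdII2008, Lem 3.2 pp.25-26]. Infrastructure for the discharge of
(ii), (vi), (vii) of `CircleOpens.lean` (abc-iut-L1-t4): inside a proper arc `B = exp(i·(c, d))`
(`d - c ≤ 2π`) containing `A = exp(i·(a, b))`, `c ≤ a < b ≤ d`, the `(A, B)`-subsets are exactly the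
arcs `exp(i·(a', b'))` with `c ≤ a' ≤ a`, `b ≤ b' ≤ d` (`isSub_arc_iff`), ordered by their
endpoints; consequently condition (b) of Lemma 3.2 (vi) always holds for `B ≠ S¹`
(`condB_of_arc`), and conditions (a), (c) are both equivalent to "`A` and `B` share an endpoint"
(`condA_arc_iff`, `condC_arc_iff`). Also: the integer shift normalising a sub-arc
(`exists_int_shift_Ioo_subset`). All statements PROVED; no item of Lemma 3.2 is restated.
-/

namespace Literature.AlgebraicGeometry.Frobenioids

open Set Function Topology Real
open scoped Pointwise

noncomputable section

namespace CircleOpens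

/-! ### Shifting a sub-arc into the period of a containing arc -/

/-- If `exp(i·(c₁, d₁)) ⊆ exp(i·(c, d))` with `d - c ≤ 2π`, some `2πℤ`-translate of `(c₁, d₁)` lies in
`(c, d)` (the lift `x ↦ lift(exp(ix)) - x` is continuous on `(c₁, d₁)` with values in `2πℤ`).
[cite: MochizukiFrdII2008, Lem 3.2 p.25] -/
theorem exists_int_shift_Ioo_subset {c₁ d₁ c d : ℝ} (h₁ : c₁ < d₁) (hcd : d - c ≤ 2 * π)
    (hsub : Circle.exp '' Ioo c₁ d₁ ⊆ Circle.exp '' Ioo c d) :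
    ∃ k : ℤ, Ioo (c₁ + k * (2 * π)) (d₁ + k * (2 * π)) ⊆ Ioo c d := by
  have hlift : ∀ x ∈ Ioo c₁ d₁, liftIco c (Circle.exp x) ∈ Ioo c d ∧
      ∃ k : ℤ, liftIco c (Circle.exp x) - x = k * (2 * π) := by
    intro x hx
    obtain ⟨y, hy, hxy⟩ := hsub ⟨x, hx, rfl⟩
    have hyI : y ∈ Ico c (c + 2 * π) := ⟨hy.1.le, by linarith [hy.2]⟩
    have hl : liftIco c (Circle.exp x) = y := by rw [← hxy, liftIco_exp hyI]
    refine ⟨hl ▸ hy, ?_⟩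
    obtain ⟨m, hm⟩ := Circle.exp_eq_exp.mp hxy
    exact ⟨m, by rw [hl, hm]; ring⟩
  set F : ℝ → ℝ := fun x => liftIco c (Circle.exp x) - x with hF_def
  have hF : ContinuousOn F (Ioo c₁ d₁) := by
    intro x hx
    refine ContinuousAt.continuousWithinAt (ContinuousAt.sub ?_ continuousAt_id)
    refine (continuousAt_liftIco ?_).comp Circle.exp.continuous.continuousAt
    intro e
    have := (hlift x hx).1
    rw [e, liftIco_exp ⟨le_rfl, by linarith [two_pi_pos]⟩] at this
    exact lt_irrefl _ this.1
  have hmaps : MapsTo F (Ioo c₁ d₁) (AddSubgroup.zmultiples (2 * π) : Set ℝ) := by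
    intro x hx
    obtain ⟨k, hk⟩ := (hlift x hx).2
    exact ⟨k, by show (k : ℤ) • (2 * π) = F x; rw [zsmul_eq_mul]; exact hk.symm⟩
  have hdisc : IsDiscrete (AddSubgroup.zmultiples (2 * π) : Set ℝ) :=
    isDiscrete_iff_discreteTopology.mpr
      (inferInstanceAs (DiscreteTopology (AddSubgroup.zmultiples (2 * π))))
  obtain ⟨x₀, hx₀⟩ : (Ioo c₁ d₁).Nonempty := nonempty_Ioo.mpr h₁
  obtain ⟨k, hk⟩ := (hlift x₀ hx₀).2
  refine ⟨k, fun x hx => ?_⟩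
  -- `x = x' + k 2π` with `x' ∈ (c₁, d₁)`, and `lift(exp(ix')) = x' + F x₀ = x' + k 2π = x`
  set x' := x - k * (2 * π) with hx'
  have hx'mem : x' ∈ Ioo c₁ d₁ := ⟨by rw [hx']; linarith [hx.1], by rw [hx']; linarith [hx.2]⟩
  have hc' := isPreconnected_Ioo.constant_of_mapsTo hdisc hF hmaps hx'mem hx₀
  have : liftIco c (Circle.exp x') = x := by
    have e : F x' = k * (2 * π) := hc'.trans hk
    simp only [hF_def] at e
    rw [hx'] at e ⊢
    linarith
  rw [← this]
  exact (hlift x' hx'mem).1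

/-- `exp(i·(a + 2πk, b + 2πk)) = exp(i·(a, b))`. [cite: MochizukiFrdII2008, Lem 3.2 p.25] -/
theorem exp_image_Ioo_add_int_mul (a b : ℝ) (k : ℤ) :
    Circle.exp '' Ioo (a + k * (2 * π)) (b + k * (2 * π)) = Circle.exp '' Ioo a b := by
  have : Ioo (a + k * (2 * π)) (b + k * (2 * π)) = (fun x => k * (2 * π) + x) '' Ioo a b := by
    rw [image_const_add_Ioo]; congr 1 <;> ring
  rw [this, image_image]
  refine image_congr fun x _ => ?_
  rw [add_comm, Circle.exp_eq_exp]
  exact ⟨k, rfl⟩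

/-- A sub-arc of `exp(i·(c, d))` (`d - c ≤ 2π`) has a representative `exp(i·(a, b))` with
`c ≤ a < b ≤ d`. [cite: MochizukiFrdII2008, Lem 3.2 p.25] -/
theorem exists_rep_of_exp_image_Ioo_subset {c₁ d₁ c d : ℝ} (h₁ : c₁ < d₁) (hcd : d - c ≤ 2 * π)
    (hsub : Circle.exp '' Ioo c₁ d₁ ⊆ Circle.exp '' Ioo c d) :
    ∃ a b : ℝ, c ≤ a ∧ a < b ∧ b ≤ d ∧ b - a = d₁ - c₁ ∧
      Circle.exp '' Ioo c₁ d₁ = Circle.exp '' Ioo a b := by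
  obtain ⟨k, hk⟩ := exists_int_shift_Ioo_subset h₁ hcd hsub
  have hk' := (Ioo_subset_Ioo_iff (by linarith : c₁ + k * (2 * π) < d₁ + k * (2 * π))).mp hk
  exact ⟨c₁ + k * (2 * π), d₁ + k * (2 * π), hk'.1, by linarith, hk'.2, by ring,
    (exp_image_Ioo_add_int_mul c₁ d₁ k).symm⟩

/-! ### Arcs inside one period: inclusion and equality are read off the endpoints -/

/-- Inside the period `[c, c + 2π)`, inclusion of open arcs is inclusion of intervals.
[cite: MochizukiFrdII2008, Lem 3.2 p.25] -/
theorem exp_image_Ioo_subset_iff {c a₁ b₁ a₂ b₂ : ℝ} (h₁ : a₁ < b₁) (hc₁ : c ≤ a₁)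
    (hb₁ : b₁ ≤ c + 2 * π) (hc₂ : c ≤ a₂) (hb₂ : b₂ ≤ c + 2 * π) :
    Circle.exp '' Ioo a₁ b₁ ⊆ Circle.exp '' Ioo a₂ b₂ ↔ a₂ ≤ a₁ ∧ b₁ ≤ b₂ := by
  rw [(Circle.exp_injOn_Ico (a := c) (b := c + 2 * π) (by linarith)).image_subset_image_iff
    (fun x hx => ⟨hc₁.trans hx.1.le, hx.2.trans_le hb₁⟩)
    (fun x hx => ⟨hc₂.trans hx.1.le, hx.2.trans_le hb₂⟩)]
  exact Ioo_subset_Ioo_iff h₁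

/-- Inside the period `[c, c + 2π)`, equality of (nonempty) open arcs is equality of endpoints.
[cite: MochizukiFrdII2008, Lem 3.2 p.25] -/
theorem exp_image_Ioo_eq_iff {c a₁ b₁ a₂ b₂ : ℝ} (h₁ : a₁ < b₁) (h₂ : a₂ < b₂) (hc₁ : c ≤ a₁)
    (hb₁ : b₁ ≤ c + 2 * π) (hc₂ : c ≤ a₂) (hb₂ : b₂ ≤ c + 2 * π) :
    Circle.exp '' Ioo a₁ b₁ = Circle.exp '' Ioo a₂ b₂ ↔ a₁ = a₂ ∧ b₁ = b₂ := by
  constructor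
  · intro h
    have h12 := (exp_image_Ioo_subset_iff h₁ hc₁ hb₁ hc₂ hb₂).mp h.le
    have h21 := (exp_image_Ioo_subset_iff h₂ hc₂ hb₂ hc₁ hb₁).mp h.symm.le
    exact ⟨le_antisymm h21.1 h12.1, le_antisymm h12.2 h21.2⟩
  · rintro ⟨rfl, rfl⟩
    rfl

/-! ### `(A, B)`-subsets of a proper arc -/

section Arc

variable {c d a b : ℝ} (hcd : d - c ≤ 2 * π) (hca : c ≤ a) (hab : a < b) (hbd : b ≤ d)

include hcd hca hab hbd

/-- **`(A, B)`-subsets of a proper arc.** For `B = exp(i·(c, d))`, `d - c ≤ 2π`, and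
`A = exp(i·(a, b))`, `c ≤ a < b ≤ d`: `C` is an `(A, B)`-subset iff `C = exp(i·(a', b'))` with
`c ≤ a' ≤ a` and `b ≤ b' ≤ d`. [cite: MochizukiFrdII2008, Lem 3.2 p.25] -/
theorem isSub_arc_iff {C : Set Circle} :
    IsSub (Circle.exp '' Ioo a b) (Circle.exp '' Ioo c d) C ↔
      ∃ a' b' : ℝ, c ≤ a' ∧ a' ≤ a ∧ b ≤ b' ∧ b' ≤ d ∧ C = Circle.exp '' Ioo a' b' := by
  constructor
  · rintro ⟨hC, hCo, hAC, hCB⟩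
    have hcC : Circle.exp c ∉ C := fun h => exp_left_notMem hcd (hCB h)
    obtain ⟨a', b', hca', ha'b', hb'2, rfl⟩ := exists_eq_exp_image_Ioo_of_notMem hC hCo hcC
    have h1 := (exp_image_Ioo_subset_iff hab hca (by linarith) hca' hb'2).mp hAC
    have h2 := (exp_image_Ioo_subset_iff ha'b' hca' hb'2 le_rfl (by linarith)).mp hCB
    exact ⟨a', b', hca', h1.1, h1.2, h2.2, rfl⟩
  · rintro ⟨a', b', hca', ha'a, hbb', hb'd, rfl⟩
    have ha'b' : a' < b' := by linarith
    refine ⟨isConnected_exp_image_Ioo ha'b', isOpen_exp_image isOpen_Ioo, ?_, ?_⟩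
    · exact image_mono (Ioo_subset_Ioo ha'a hbb')
    · exact image_mono (Ioo_subset_Ioo hca' hb'd)
  where
  /-- `exp(ic) ∉ exp(i·(c, d))` for `d - c ≤ 2π`. -/
  exp_left_notMem {c d : ℝ} (hcd : d - c ≤ 2 * π) : Circle.exp c ∉ Circle.exp '' Ioo c d := by
    rintro ⟨x, hx, hxe⟩
    exact hx.1.ne' (Circle.exp_injOn_Ico (a := c) (b := c + 2 * π) (by linarith)
      ⟨hx.1.le, by linarith [hx.2]⟩ ⟨le_rfl, by linarith [two_pi_pos]⟩ hxe)

/-- **Condition (b) of Lemma 3.2 (vi) holds for every pair inside a proper arc**: between two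
distinct nested `(A, B)`-subsets `exp(i·(a₁, b₁)) ⊊ exp(i·(a₂, b₂))` lies the arc with the averaged
endpoints. [cite: MochizukiFrdII2008, Lem 3.2 (vi)(b) p.26] -/
theorem condB_of_arc : CondB (Circle.exp '' Ioo a b) (Circle.exp '' Ioo c d) := by
  intro A₁ A₂ h₁ h₂ h12 hne
  obtain ⟨a₁, b₁, hca₁, ha₁, hb₁, hb₁d, rfl⟩ := (isSub_arc_iff hcd hca hab hbd).mp h₁
  obtain ⟨a₂, b₂, hca₂, ha₂, hb₂, hb₂d, rfl⟩ := (isSub_arc_iff hcd hca hab hbd).mp h₂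
  have ha₁b₁ : a₁ < b₁ := by linarith
  have ha₂b₂ : a₂ < b₂ := by linarith
  have hper₁ : b₁ ≤ c + 2 * π := by linarith
  have hper₂ : b₂ ≤ c + 2 * π := by linarith
  have h12' := (exp_image_Ioo_subset_iff ha₁b₁ hca₁ hper₁ hca₂ hper₂).mp h12
  refine ⟨Circle.exp '' Ioo ((a₁ + a₂) / 2) ((b₁ + b₂) / 2), ⟨isConnected_exp_image_Ioo (by linarith),
    isOpen_exp_image isOpen_Ioo, image_mono (Ioo_subset_Ioo (by linarith) (by linarith)),
    image_mono (Ioo_subset_Ioo (by linarith) (by linarith))⟩, ?_, ?_⟩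
  · intro h
    have := (exp_image_Ioo_eq_iff (by linarith) ha₁b₁ (by linarith) (by linarith) hca₁ hper₁).mp h
    apply hne
    rw [(exp_image_Ioo_eq_iff ha₁b₁ ha₂b₂ hca₁ hper₁ hca₂ hper₂).mpr ⟨by linarith, by linarith⟩]
  · intro h
    have := (exp_image_Ioo_eq_iff (by linarith) ha₂b₂ (by linarith) (by linarith) hca₂ hper₂).mp h
    apply hne
    rw [(exp_image_Ioo_eq_iff ha₁b₁ ha₂b₂ hca₁ hper₁ hca₂ hper₂).mpr ⟨by linarith, by linarith⟩]

/-- **Condition (a) of Lemma 3.2 (vi) inside a proper arc** holds iff `A` and `B` share an endpoint.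
[cite: MochizukiFrdII2008, Lem 3.2 (vi)(a) p.25] -/
theorem condA_arc_iff : CondA (Circle.exp '' Ioo a b) (Circle.exp '' Ioo c d) ↔ (a = c ∨ b = d) := by
  constructor
  · intro hA
    by_contra h
    rw [not_or] at h
    have hca' : c < a := lt_of_le_of_ne hca (Ne.symm h.1)
    have hbd' : b < d := lt_of_le_of_ne hbd h.2
    have h₁ : IsSub (Circle.exp '' Ioo a b) (Circle.exp '' Ioo c d) (Circle.exp '' Ioo c b) :=
      (isSub_arc_iff hcd hca hab hbd).mpr ⟨c, b, le_rfl, hca, le_rfl, hbd, rfl⟩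
    have h₂ : IsSub (Circle.exp '' Ioo a b) (Circle.exp '' Ioo c d) (Circle.exp '' Ioo a d) :=
      (isSub_arc_iff hcd hca hab hbd).mpr ⟨a, d, hca, le_rfl, hbd, le_rfl, rfl⟩
    rcases hA _ _ h₁ h₂ with h | h
    · have := (exp_image_Ioo_subset_iff (by linarith) le_rfl (by linarith) hca (by linarith)).mp h
      linarith [this.1]
    · have := (exp_image_Ioo_subset_iff (by linarith) hca (by linarith) le_rfl (by linarith)).mp h
      linarith [this.2]
  · intro h A₁ A₂ h₁ h₂
    obtain ⟨a₁, b₁, hca₁, ha₁, hb₁, hb₁d, rfl⟩ := (isSub_arc_iff hcd hca hab hbd).mp h₁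
    obtain ⟨a₂, b₂, hca₂, ha₂, hb₂, hb₂d, rfl⟩ := (isSub_arc_iff hcd hca hab hbd).mp h₂
    have ha₁b₁ : a₁ < b₁ := by linarith
    have ha₂b₂ : a₂ < b₂ := by linarith
    rcases h with rfl | rfl
    · have e₁ : a₁ = a := le_antisymm ha₁ hca₁
      have e₂ : a₂ = a := le_antisymm ha₂ hca₂
      subst e₁ e₂
      rcases le_total b₁ b₂ with hb | hb
      · exact Or.inl (image_mono (Ioo_subset_Ioo le_rfl hb))
      · exact Or.inr (image_mono (Ioo_subset_Ioo le_rfl hb))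
    · have e₁ : b₁ = b := le_antisymm hb₁d hb₁
      have e₂ : b₂ = b := le_antisymm hb₂d hb₂
      subst e₁ e₂
      rcases le_total a₁ a₂ with ha | ha
      · exact Or.inr (image_mono (Ioo_subset_Ioo ha le_rfl))
      · exact Or.inl (image_mono (Ioo_subset_Ioo ha le_rfl))

/-- The complement `B \ A` of `A = exp(i·(a, b))` in `B = exp(i·(c, d))` is `exp(i·((c, a] ∪ [b, d)))`.
[cite: MochizukiFrdII2008, Lem 3.2 (vi)(c) p.26] -/
theorem arc_diff_arc :
    Circle.exp '' Ioo c d \ Circle.exp '' Ioo a b = Circle.exp '' (Ioc c a ∪ Ico b d) := by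
  have hinj := Circle.exp_injOn_Ico (a := c) (b := c + 2 * π) (by linarith)
  ext z
  constructor
  · rintro ⟨⟨x, hx, rfl⟩, hz⟩
    refine ⟨x, ?_, rfl⟩
    have hx' : x ∉ Ioo a b := fun h => hz ⟨x, h, rfl⟩
    rcases le_or_gt x a with h | h
    · exact Or.inl ⟨hx.1, h⟩
    · exact Or.inr ⟨not_lt.mp (fun hb => hx' ⟨h, hb⟩), hx.2⟩
  · rintro ⟨x, hx, rfl⟩
    have hxcd : x ∈ Ioo c d := by
      rcases hx with h | h
      · exact ⟨h.1, by linarith [h.2]⟩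
      · exact ⟨by linarith [h.1], h.2⟩
    refine ⟨⟨x, hxcd, rfl⟩, ?_⟩
    rintro ⟨y, hy, hxy⟩
    have hyx : y = x := hinj ⟨hca.trans hy.1.le, by linarith [hy.2]⟩
      ⟨hxcd.1.le, by linarith [hxcd.2]⟩ hxy
    subst hyx
    rcases hx with h | h
    · linarith [h.2, hy.1]
    · linarith [h.1, hy.2]

/-- **Condition (c) of Lemma 3.2 (vi) inside a proper arc** ("`B \ A` is connected") holds iff `A`
and `B` share an endpoint: otherwise the lift to `(c, c + 2π)` maps `B \ A` continuously onto
`(c, a] ∪ [b, d)`, which is not an interval. [cite: MochizukiFrdII2008, Lem 3.2 (vi)(c) p.26] -/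
theorem condC_arc_iff : CondC (Circle.exp '' Ioo a b) (Circle.exp '' Ioo c d) ↔ (a = c ∨ b = d) := by
  unfold CondC
  rw [arc_diff_arc hcd hca hab hbd]
  constructor
  · intro hpc
    by_contra h
    rw [not_or] at h
    have hca' : c < a := lt_of_le_of_ne hca (Ne.symm h.1)
    have hbd' : b < d := lt_of_le_of_ne hbd h.2
    -- the lift is continuous on the set and recovers the parameter
    have hsub : Ioc c a ∪ Ico b d ⊆ Ico c (c + 2 * π) := by
      rintro x (hx | hx)
      · exact ⟨hx.1.le, by linarith [hx.2]⟩
      · exact ⟨by linarith [hx.1], by linarith [hx.2]⟩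
    have hcont : ContinuousOn (liftIco c) (Circle.exp '' (Ioc c a ∪ Ico b d)) := by
      refine continuousOn_of_forall_continuousAt ?_
      rintro _ ⟨x, hx, rfl⟩
      refine continuousAt_liftIco fun e => ?_
      have := Circle.exp_injOn_Ico (a := c) (b := c + 2 * π) (by linarith) (hsub hx)
        ⟨le_rfl, by linarith [two_pi_pos]⟩ e
      subst this
      rcases hx with h | h
      · exact lt_irrefl _ h.1
      · linarith [h.1]
    have himg : liftIco c '' (Circle.exp '' (Ioc c a ∪ Ico b d)) = Ioc c a ∪ Ico b d := by
      rw [image_image]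
      have : ∀ x ∈ Ioc c a ∪ Ico b d, liftIco c (Circle.exp x) = x :=
        fun x hx => liftIco_exp (hsub hx)
      rw [image_congr this, image_id']
    have hpc' := hpc.image _ hcont
    rw [himg, isPreconnected_iff_ordConnected] at hpc'
    have hm := hpc'.out (Or.inl ⟨hca', le_rfl⟩ : a ∈ Ioc c a ∪ Ico b d)
      (Or.inr ⟨le_rfl, hbd'⟩ : b ∈ Ioc c a ∪ Ico b d) ⟨(by linarith : a ≤ (a + b) / 2), by linarith⟩
    rcases hm with h | h
    · linarith [h.2]
    · linarith [h.1]
  · rintro (rfl | rfl)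
    · rw [Ioc_self, empty_union]
      exact (isPreconnected_Ico).image _ Circle.exp.continuous.continuousOn
    · rw [Ico_self, union_empty]
      exact (isPreconnected_Ioc).image _ Circle.exp.continuous.continuousOn

end Arc

end CircleOpens

end

end Literature.AlgebraicGeometry.Frobenioids
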